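import Summits.BirchSwinnertonDyer.BirchSwinnertonDyer.Statement
import Literature.NumberTheory.EllipticCurves.Rank1Residual.ClassX1KellerYin
import Literature.NumberTheory.EllipticCurves.KellerYin2024.AnomalousBSD
import Literature.NumberTheory.EllipticCurves.IwasawaLeadingTerm
import Literature.NumberTheory.EllipticCurves.Rank1Residual.ClassX1KellerYinPartner
import Literature.NumberTheory.EllipticCurves.GreenbergVatsal2000.IwasawaInvariants
import Literature.NumberTheory.EllipticCurves.Rank1Residual.ClassX1KellerYinRankOneReduction
import Literature.NumberTheory.EllipticCurves.Rank1Residual.GVParityIsogenyClassProofs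

/-!
# Rank-≤1 BSD residual class X1 (Eisenstein anomalous good `p`): the typed MISSING INPUT and the
# class theorems with every hypothesis BY NAME

HONEST FRAMING (cell `b2b-bsdres`, home `run/shared/lean/b2b/bsd-rank1-residual/`, unit
`b2b-bsdres-x1a`). The goal is to DELETE the COMBINATION-SHAPED residual classes for ALL
analytic-rank `≤ 1` curves over `ℚ` — "full BSD formula for every rank `≤ 1` curve in class C"
assembled STRICTLY from published theorems — so that the rank-`≤ 1` remainder becomes exactly the
CONSTRUCTION-SHAPED classes, which are TYPED (missing-input `Prop`s), NOT attempted; this is not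
"finishing BSD". Helper file of the crux `PAdicOrderMainConjectureR5` (stmt-BirchSwinnertonDyer-15418:
the cyclotomic main conjecture at a good ordinary `p ≥ 5` with `E[p]` IRREDUCIBLE, in `Λ ⊗ ℚ_p`): it
types the REDUCIBLE (Eisenstein) counterpart that the residual class X1 of the rank-`≤ 1` census
needs, and assembles the X1 class theorems from the Literature files of the Keller–Yin route
(`Rank1Residual/ClassX1KellerYin.lean`, `KellerYin2024/AnomalousRankZeroProofs.lean`,
`KellerYin2024/AnomalousBSD.lean`, `LeadingTermPPartEisensteinProofs.lean`; audit
`b2b-bsdres-x1a/X1-CHAIN.md`) with EVERY hypothesis a NAMED `Prop`: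

* `MazurMainConjecture W p` (`@[conjecture]`, TYPED MISSING INPUT): Mazur's cyclotomic main conjecture
  for ONE `(E, p)` in the NÉRON normalisation, `char_Λ X(E/ℚ_∞) = (ϖ · L_p(f, α))`, `ϖ · Ω_E = Ω⁺_f`
  (Castella–Grossi–Skinner, Math. Ann. 393 (2025), Introduction (MC), after Mazur 1972) — the
  spelling of the hypothesis `hMC` of `padicValRat_bsd_rank_zero_of_mazurMainConjecture`. THEOREM in
  print for `E[p]` irreducible under bsd.S21's hypotheses, for Eisenstein `p` under (GV)
  (Greenberg–Vatsal 2000 Thm. 1.3; tree fact `GreenbergVatsal2000.thm13_charIdeal_eq_of_gvPar`,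
  proposed) and under `φ|_{G_p} ≠ 1, ω` (CGS 2025 Thm. 1); OPEN at an ANOMALOUS Eisenstein prime of
  type A = (unramified-even)/(ramified-odd) kernel characters (e.g. `11a1@5`, `14a1@3`, `26b1@7`),
  where Keller–Yin (arXiv:2402.12781v2 §0.5) and M. Yin (arXiv:2410.24193 §0.2) CLAIM it in prose
  without a stated theorem.
* `MazurMainConjectureOnX1TypeA` (`@[conjecture]`): the same restricted to exactly the open locus —
  class X1 of type A (`ClassX1 W p ∧ ¬ GVPar W p`). This `Prop` IS the residue of X1 ∩ {r = 0} and of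
  X1 ∩ {r = 1, type B} (through the twist partner) after the Keller–Yin route.
* `bsdp_of_classX1_of_analyticRank_eq_zero` — X1 ∩ {r = 0} ⇒ Miller's `BSD(E,p)`, from the named
  inputs `MazurMainConjecture W p` (OPEN), `greenberg_charValue_rankZero` (Greenberg LNM 1716
  Thm. 4.1, PUB), `nonempty_modularParametrizationData` (modularity, PUB),
  `rank_eq_analyticRank_of_analyticRank_le_one` (Gross–Zagier–Kolyvagin, PUB).
* `bsdp_of_classX1_of_analyticRank_eq_one` — X1 ∩ {r = 1} ⇒ `BSD(E,p)`, from
  `KellerYin2024.thm421_rankOne_display_OPEN` (KY's rank-one display: links KY Thm. 3.0.11 + 7.0.6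
  PREPRINT, Gross–Zagier / Bertolini–Darmon–Prasanna / Kolyvagin PUB), `exists_isNewformOf`,
  `HoffsteinLuo1997_exists_twist_L_one_ne_zero`, `GrossZagier1986_thm_I_7_3`,
  `rank_eq_analyticRank_of_analyticRank_le_one` (all PUB) and the partner input `hpartner` (rank-`0`
  print shape of the admissible twist: PUB = Greenberg–Vatsal + Greenberg + Mazur–Swinnerton-Dyer for
  type A, = `MazurMainConjectureOnX1TypeA` for the twist when `E` is of type B).

References: [KellerYin2024] Thm. 4.2.1, §0.5; [CastellaGrossiSkinner2025] (MC), Thms. 1, 4;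
[CastellaEtAl2021] Thms. 5.1.4, 5.3.1; [GreenbergVatsal2000] Thm. 1.3; [GreenbergLNM1716] Thm. 4.1;
[Miller2011LMS] Def. 1.1.
-/

noncomputable section

open scoped Classical MatrixGroups ModularForm

open CongruenceSubgroup WeierstrassCurve Literature.NumberTheory.EllipticCurves
  Literature.NumberTheory.EllipticCurves.ModularForms Literature.NumberTheory.EllipticCurves.Rank1Residual

set_option linter.dupNamespace false
set_option autoImplicit false

namespace Summit.BirchSwinnertonDyer.BirchSwinnertonDyer.Theorems.Rank1ResidualX1Defs

/-- **TYPED MISSING INPUT — Mazur's main conjecture for `(E, p)`, Néron normalisation.** For a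
globally minimal model `W` of an elliptic curve `E/ℚ` and a prime `p`: for the cyclotomic
`ℤ_p`-extension `κ` with a topological generator `γ` matching the cyclotomic variable, the newform `f`
of `E` at level `N_E`, the rational `ϖ` with `ϖ · Ω_E = Ω⁺_f`, and every Pontryagin-dual datum `D`
(`X = X(E/ℚ_∞)`): `X` is `Λ`-torsion and `char_Λ X = (g)` with `ι g = ϖ · L_p(f, α)`
(`α = unitRoot W p`) — "`ch_{Λ_ℚ}(𝔛_ord(E/ℚ_∞)) = (𝓛_p^{MSD}(E/ℚ))`" (Castella–Grossi–Skinner 2025,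
Introduction, (MC); Mazur 1972). Open in general; see the module docstring for the cases in print.
[cite: CastellaGrossiSkinner2025, Introduction (MC)] -/
@[conjecture] def MazurMainConjecture (W : WeierstrassCurve ℚ) [W.IsElliptic] [W.IsGloballyMinimal]
    (p : ℕ) [Fact p.Prime] : Prop :=
  ∀ (κ : ZpExtension ℚ p) (γ : Field.absoluteGaloisGroup ℚ),
      κ.IsCyclotomic → κ.IsTopGenerator γ → IsCyclotomicVariable p γ →
    ∀ [NeZero (W.conductorNorm ℤ)] (f : CuspForm (Gamma0 (W.conductorNorm ℤ)) 2),
      IsNewformOf W f → ∀ (ϖ : ℚ), (ϖ : ℝ) * W.realPeriodRat = plusPeriod f →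
    ∀ (D : W.SelmerDualData κ γ), D.IsTorsion ∧
      ∃ g : IwasawaAlgebra p, D.charIdeal = Ideal.span {g} ∧
        iwasawaToPowerSeries p g =
          PowerSeries.C (ϖ : ℚ_[p]) * padicLFunction f (unitRoot W p : ℚ_[p])

/-- **TYPED MISSING INPUT OF CLASS X1 (the residue after the Keller–Yin route).** Mazur's main
conjecture at an anomalous Eisenstein prime of parity type A: for every globally minimal elliptic
`W/ℚ` and prime `p` with `ClassX1 W p` (`2 < p`, `E[p]` reducible, good reduction, `a_p ≡ 1 (mod p)`,
`¬(r = 0 ∧ gvpar)`) and `¬ GVPar W p` (no rational `p`-isogeny kernel of type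
(ramified ∧ even) ∨ (unramified ∧ odd)), `MazurMainConjecture W p`. Not in print (Greenberg–Vatsal
2000 Thm. 1.3 is type B; Castella–Grossi–Skinner 2025 Thm. 1 is `φ|_{G_p} ≠ 1, ω`); claimed in prose
by Keller–Yin arXiv:2402.12781v2 §0.5 and M. Yin arXiv:2410.24193 §0.2.
[cite: KellerYin2024, §0.5 (prose claim); CastellaGrossiSkinner2025, Thm. 1 (excluded case)] -/
@[conjecture] def MazurMainConjectureOnX1TypeA : Prop :=
  ∀ (W : WeierstrassCurve ℚ) [W.IsElliptic] [W.IsGloballyMinimal] (p : ℕ) [Fact p.Prime],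
    ClassX1 W p → ¬ GVPar W p → MazurMainConjecture W p

/-- **TYPED TARGET — the class statement X1.** For every globally minimal elliptic `W/ℚ` and prime
`p` with `ClassX1 W p` and `ord_{s=1} L(E,s) ≤ 1`, Miller's `BSD(E,p)` (`BSDp W p`). Announced by
Keller–Yin (arXiv:2402.12781v2, Thm. 3 = Thm. 4.2.1; preprint); not a theorem of the published record
(see `bsdpOnClassX1_of_typedInputs` for exactly what it rests on). [cite: KellerYin2024, Thm. 4.2.1 (p. 22)] -/
@[conjecture] def BSDpOnClassX1 : Prop :=
  ∀ (W : WeierstrassCurve ℚ) [W.IsElliptic] [W.IsGloballyMinimal] (p : ℕ) [Fact p.Prime],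
    ClassX1 W p → W.analyticRank ≤ 1 → BSDp W p

/-- **TYPED PARTNER INPUT (rank 1).** For every X1 pair `(E, p)` with `ord_{s=1} L(E,s) = 1`, every
admissible auxiliary field `K` ([CGLS] Thm. 5.3.1 (a)–(d): imaginary quadratic, `D_K < -4` odd, every
`ℓ ∣ N_E` and `p` split, `L(E^K,1) ≠ 0`) and every globally minimal model `Wd` of `E^K` with
`ord_{s=1} L(E^K,s) = 0`: the rank-`0` print shape `PPartRankZero Wd p` — [CGLS] Thm. 5.1.4 for `E^K`.
PUBLISHED when `E` is of type A (`¬ GVPar W p`): then `E^K` satisfies (GV) and Greenberg–Vatsal 2000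
Thm. 1.3 + Kato + Greenberg Thm. 4.1 + Mazur–Swinnerton-Dyer give it (tree:
`padicValRat_bsd_rank_zero_of_mazurMainConjecture` with the fact
`GreenbergVatsal2000.thm13_charIdeal_eq_of_gvPar`, modulo the twist-parity lemma "type A for `E` ⇔
(GV) for `E^K`", not yet formalised); OPEN when `E` is of type B (`E^K` is then anomalous of type A:
`MazurMainConjectureOnX1TypeA`-shaped). [cite: CastellaEtAl2021, Thm. 5.1.4 and proof of Thm. 5.3.1] -/
@[conjecture] def PartnerPPartRankZeroOnX1 : Prop :=
  ∀ (W : WeierstrassCurve ℚ) [W.IsElliptic] [W.IsGloballyMinimal] (p : ℕ) [Fact p.Prime],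
    ClassX1 W p → W.analyticRank = 1 →
    ∀ (K : Type) [Field K] [NumberField K], IsImaginaryQuadratic K →
      Odd (NumberField.discr K) → NumberField.discr K < -4 →
      SatisfiesHeegnerHypothesis (W.conductorNorm ℤ) K → SatisfiesHeegnerHypothesis p K →
      (W.quadraticTwist (NumberField.discr K : ℚ)).entireLFunction 1 ≠ 0 →
    ∀ (Wd : WeierstrassCurve ℚ) [Wd.IsElliptic] [Wd.IsGloballyMinimal],
      (∃ C : VariableChange ℚ, C • Wd = W.quadraticTwist (NumberField.discr K : ℚ)) →
      Wd.analyticRank = 0 → PPartRankZero Wd p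

/-- **X1 ∩ {r = 0} ⇒ `BSD(E,p)`, every input by name.** For `W/ℚ` globally minimal elliptic and a
prime `p` with `ClassX1 W p` and `ord_{s=1} L(E,s) = 0`: from `MazurMainConjecture W p` (OPEN input),
Greenberg's Euler characteristic formula (`greenberg_charValue_rankZero`, LNM 1716 Thm. 4.1),
modularity with integral Manin constant (`nonempty_modularParametrizationData`) and
Gross–Zagier–Kolyvagin (`rank_eq_analyticRank_of_analyticRank_le_one`), Miller's `BSD(E,p)` holds —
Keller–Yin Thm. 4.2.1 in rank `0` by its own printed argument ([CGS] Thm. 4 ⇒ [CGLS] Thm. 5.1.4).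
[cite: KellerYin2024, Thm. 4.2.1 (p. 22)] [cite: CastellaEtAl2021, Thm. 5.1.4] -/
theorem bsdp_of_classX1_of_analyticRank_eq_zero
    (hGr : greenberg_charValue_rankZero) (hmod : nonempty_modularParametrizationData)
    (hGZK : rank_eq_analyticRank_of_analyticRank_le_one)
    (W : WeierstrassCurve ℚ) [W.IsElliptic] [W.IsGloballyMinimal] (p : ℕ) [Fact p.Prime]
    (hX1 : ClassX1 W p) (hr : W.analyticRank = 0) (hMC : MazurMainConjecture W p) :
    BSDp W p := by
  have hp2 : p ≠ 2 := by have := hX1.1; omega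
  have hgood : W.HasGoodReductionAtPrime p := hX1.2.2.1
  have hanom : (p : ℤ) ∣ W.frobeniusTrace p - 1 := hX1.2.2.2.1.2.2
  have hord : ¬ (p : ℤ) ∣ W.frobeniusTrace p :=
    KellerYin2024.not_dvd_frobeniusTrace_of_anomalous W p hanom
  exact bsdp_of_classX1_of_analyticRank_eq_zero_of_mazurMC_OPEN W p hX1 hr hmod hGZK
    (fun κ γ hκ hγ hγ' D _ hX fE hfE hSel ↦ hGr W p hp2 hgood hord κ γ hκ hγ hγ' D hX fE hfE hSel) hMC

/-- **The residue form**: on X1 ∩ {r = 0} of type A, `BSD(E,p)` follows from the single typed missing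
input `MazurMainConjectureOnX1TypeA` and the published named facts. (On type B with `r = 0` the pair
is in the covered class C7 and `MazurMainConjecture W p` is Greenberg–Vatsal's theorem.)
[cite: KellerYin2024, Thm. 4.2.1 (p. 22) and §0.5] -/
theorem bsdp_of_classX1_typeA_of_analyticRank_eq_zero (hA : MazurMainConjectureOnX1TypeA)
    (hGr : greenberg_charValue_rankZero) (hmod : nonempty_modularParametrizationData)
    (hGZK : rank_eq_analyticRank_of_analyticRank_le_one)
    (W : WeierstrassCurve ℚ) [W.IsElliptic] [W.IsGloballyMinimal] (p : ℕ) [Fact p.Prime]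
    (hX1 : ClassX1 W p) (hnot : ¬ GVPar W p) (hr : W.analyticRank = 0) : BSDp W p :=
  bsdp_of_classX1_of_analyticRank_eq_zero hGr hmod hGZK W p hX1 hr (hA W p hX1 hnot)

/-- **X1 ∩ {r = 1} ⇒ `BSD(E,p)`, along Keller–Yin's printed proof, inputs by name.** For `W/ℚ`
globally minimal elliptic, `p` with `ClassX1 W p` and `ord_{s=1} L(E,s) = 1`: from Keller–Yin's
rank-one display (`KellerYin2024.thm421_rankOne_display_OPEN`: KY Thms. 3.0.11 + 7.0.6, PREPRINT, with
the published Gross–Zagier / Bertolini–Darmon–Prasanna / Kolyvagin links), modularity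
(`exists_isNewformOf`), Hoffstein–Luo (`HoffsteinLuo1997_exists_twist_L_one_ne_zero`), Gross–Zagier
I.7.3 (`GrossZagier1986_thm_I_7_3`), Gross–Zagier–Kolyvagin, and the partner input `hpartner` — the
rank-`0` print shape for the admissible twist `E^K` ([CGLS] Thm. 5.1.4: PUBLISHED via Greenberg–Vatsal
when `E` is of type A; = Mazur's main conjecture for the anomalous type-A curve `E^K` when `E` is of
type B). [cite: KellerYin2024, Thm. 4.2.1 and its proof (p. 22)] [cite: CastellaEtAl2021, Thm. 5.3.1] -/
theorem bsdp_of_classX1_of_analyticRank_eq_one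
    (hKY : KellerYin2024.thm421_rankOne_display_OPEN)
    (hmod : exists_isNewformOf) (hHL : HoffsteinLuo1997_exists_twist_L_one_ne_zero)
    (hGZ : GrossZagier1986_thm_I_7_3) (hGZK : rank_eq_analyticRank_of_analyticRank_le_one)
    (W : WeierstrassCurve ℚ) [W.IsElliptic] [W.IsGloballyMinimal] (p : ℕ) [Fact p.Prime]
    (hX1 : ClassX1 W p) (hr : W.analyticRank = 1)
    (hpartner : ∀ (K : Type) [Field K] [NumberField K], IsImaginaryQuadratic K →
        Odd (NumberField.discr K) → NumberField.discr K < -4 →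
        SatisfiesHeegnerHypothesis (W.conductorNorm ℤ) K → SatisfiesHeegnerHypothesis p K →
        (W.quadraticTwist (NumberField.discr K : ℚ)).entireLFunction 1 ≠ 0 →
      ∀ (Wd : WeierstrassCurve ℚ) [Wd.IsElliptic] [Wd.IsGloballyMinimal],
        (∃ C : VariableChange ℚ, C • Wd = W.quadraticTwist (NumberField.discr K : ℚ)) →
        Wd.analyticRank = 0 → PPartRankZero Wd p) :
    BSDp W p :=
  bsdp_of_classX1_of_analyticRank_eq_one_of_KY_OPEN W p hX1 hr hmod hHL hGZ hGZK hKY hpartner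

/-- **The class statement X1 from its typed inputs** (what the Keller–Yin route gives from the
PUBLISHED record, and what it does not). `BSDpOnClassX1` follows from: the TYPED OPEN inputs
`MazurMainConjectureOnX1TypeA` (rank `0`: within X1, `r = 0` forces type A by the class predicate's
clause `¬(r = 0 ∧ gvpar)`), `KellerYin2024.thm421_rankOne_display_OPEN` (KY Thms. 3.0.11 + 7.0.6) and
`PartnerPPartRankZeroOnX1` (published for type A, open for type B); and the PUBLISHED named facts
`greenberg_charValue_rankZero` (Greenberg 1999 Thm. 4.1), `nonempty_modularParametrizationData` and
`exists_isNewformOf` (modularity), `HoffsteinLuo1997_exists_twist_L_one_ne_zero` (Hoffstein–Luo 1997),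
`GrossZagier1986_thm_I_7_3` (Gross–Zagier 1986), `rank_eq_analyticRank_of_analyticRank_le_one`
(Gross–Zagier–Kolyvagin). [cite: KellerYin2024, Thm. 4.2.1 (p. 22) and §0.5] -/
theorem bsdpOnClassX1_of_typedInputs (hA : MazurMainConjectureOnX1TypeA)
    (hKY : KellerYin2024.thm421_rankOne_display_OPEN) (hP : PartnerPPartRankZeroOnX1)
    (hGr : greenberg_charValue_rankZero) (hmod : nonempty_modularParametrizationData)
    (hmod' : exists_isNewformOf) (hHL : HoffsteinLuo1997_exists_twist_L_one_ne_zero)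
    (hGZ : GrossZagier1986_thm_I_7_3) (hGZK : rank_eq_analyticRank_of_analyticRank_le_one) :
    BSDpOnClassX1 := by
  intro W _ _ p _ hX1 hr
  rcases Nat.le_one_iff_eq_zero_or_eq_one.mp hr with h0 | h1
  · -- rank 0: the class clause `¬(r = 0 ∧ gvpar)` forces type A
    have hnot : ¬ GVPar W p := fun hgv ↦ hX1.2.2.2.2 ⟨h0, hgv⟩
    exact bsdp_of_classX1_typeA_of_analyticRank_eq_zero hA hGr hmod hGZK W p hX1 hnot h0
  · exact bsdp_of_classX1_of_analyticRank_eq_one hKY hmod' hHL hGZ hGZK W p hX1 h1 (hP W p hX1 h1)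


/-! ### The class statement from TWO typed inputs (appended): the partner input discharged

With `Rank1Residual/GVParityTwistProofs.lean` (twist-parity lemma), `Rank1Residual/ClassX1KellerYinTypeA.lean`
and `Rank1Residual/ClassX1KellerYinPartner.lean`, the rank-`0` input for the admissible twist `E^K`
(`PartnerPPartRankZeroOnX1`) is no longer a separate hypothesis: it follows from Greenberg–Vatsal 2000
Thm. 1.3 (named fact `GreenbergVatsal2000.thm13_charIdeal_eq_of_gvPar`, PUBLISHED) when `E^K` is of
parity type B, and from `MazurMainConjectureOnX1TypeA` when `E^K` is of type A (then `(E^K, p)` is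
itself a class-X1 pair of type A with `r_an = 0`). -/

/-- **X1 ∩ {r = 1, type A} ⇒ `BSD(E,p)` modulo ONLY Keller–Yin's rank-one display.** Named-input form
of `Rank1Residual.bsdp_of_classX1_typeA_of_analyticRank_eq_one_of_KY_OPEN`: inputs
`KellerYin2024.thm421_rankOne_display_OPEN` (OPEN: KY Thms. 3.0.11 + 7.0.6, arXiv:2402.12781v2) and the
PUBLISHED `GreenbergVatsal2000.thm13_charIdeal_eq_of_gvPar`, `greenberg_charValue_rankZero`,
`nonempty_modularParametrizationData`, `exists_isNewformOf`, `HoffsteinLuo1997_exists_twist_L_one_ne_zero`,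
`GrossZagier1986_thm_I_7_3`, `rank_eq_analyticRank_of_analyticRank_le_one`.
[cite: KellerYin2024, Thm. 4.2.1 and its proof (p. 22)] [cite: GreenbergVatsal2000, Thm. (1.3)] -/
theorem bsdp_of_classX1_typeA_of_analyticRank_eq_one
    (hKY : KellerYin2024.thm421_rankOne_display_OPEN)
    (hGV : GreenbergVatsal2000.thm13_charIdeal_eq_of_gvPar) (hGr : greenberg_charValue_rankZero)
    (hmod : nonempty_modularParametrizationData) (hmod' : exists_isNewformOf)
    (hHL : HoffsteinLuo1997_exists_twist_L_one_ne_zero) (hGZ : GrossZagier1986_thm_I_7_3)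
    (hGZK : rank_eq_analyticRank_of_analyticRank_le_one)
    (W : WeierstrassCurve ℚ) [W.IsElliptic] [W.IsGloballyMinimal] (p : ℕ) [Fact p.Prime]
    (hX1 : ClassX1 W p) (hA : ¬ GVPar W p) (hr : W.analyticRank = 1) : BSDp W p :=
  bsdp_of_classX1_typeA_of_analyticRank_eq_one_of_KY_OPEN hGV hGr hmod hmod' hHL hGZ hGZK W p hX1 hA hr
    hKY

/-- **The class statement X1 from TWO typed open inputs and published facts.** `BSDpOnClassX1`
(every class-X1 pair with `r_an ≤ 1` satisfies Miller's `BSD(E,p)`) follows from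
(OPEN, announced) `KellerYin2024.thm421_rankOne_display_OPEN` — Keller–Yin Thms. 3.0.11 + 7.0.6;
(OPEN, unstated in print) `MazurMainConjectureOnX1TypeA` — Mazur's (MC) at an anomalous Eisenstein
prime of parity type A (used for `r = 0`, and for `r = 1` exactly when the admissible twist is of
type A); and the PUBLISHED named facts `GreenbergVatsal2000.thm13_charIdeal_eq_of_gvPar` (GV 2000),
`greenberg_charValue_rankZero` (Greenberg 1999), `nonempty_modularParametrizationData`,
`exists_isNewformOf` (modularity), `HoffsteinLuo1997_exists_twist_L_one_ne_zero` (Hoffstein–Luo 1997),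
`GrossZagier1986_thm_I_7_3` (Gross–Zagier 1986), `rank_eq_analyticRank_of_analyticRank_le_one`
(Gross–Zagier–Kolyvagin). This supersedes `bsdpOnClassX1_of_typedInputs` (whose partner hypothesis
`PartnerPPartRankZeroOnX1` is discharged by `Rank1Residual.pPartRankZero_twist_of_mazurMC_typeA`).
[cite: KellerYin2024, Thm. 4.2.1 (p. 22) and §0.5] [cite: CastellaEtAl2021, Thms. 5.1.4, 5.3.1] -/
theorem bsdpOnClassX1_of_typedInputs' (hA : MazurMainConjectureOnX1TypeA)
    (hKY : KellerYin2024.thm421_rankOne_display_OPEN)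
    (hGV : GreenbergVatsal2000.thm13_charIdeal_eq_of_gvPar) (hGr : greenberg_charValue_rankZero)
    (hmod : nonempty_modularParametrizationData) (hmod' : exists_isNewformOf)
    (hHL : HoffsteinLuo1997_exists_twist_L_one_ne_zero) (hGZ : GrossZagier1986_thm_I_7_3)
    (hGZK : rank_eq_analyticRank_of_analyticRank_le_one) : BSDpOnClassX1 := by
  intro W _ _ p _ hX1 hr
  rcases Nat.le_one_iff_eq_zero_or_eq_one.mp hr with h0 | h1
  · have hnot : ¬ GVPar W p := fun hgv ↦ hX1.2.2.2.2 ⟨h0, hgv⟩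
    exact bsdp_of_classX1_typeA_of_analyticRank_eq_zero hA hGr hmod hGZK W p hX1 hnot h0
  · exact bsdp_of_classX1_of_analyticRank_eq_one_of_KY_OPEN_of_mazurMC_typeA hGV hGr hmod hmod' hHL
      hGZ hGZK hKY (fun W' _ _ p' _ hX1' hA' ↦ hA W' p' hX1' hA') W p hX1 h1

/-- **The partner input is not an independent hypothesis**: `PartnerPPartRankZeroOnX1` follows from
`MazurMainConjectureOnX1TypeA` and the published facts (Greenberg–Vatsal, Greenberg Thm. 4.1,
modularity, Gross–Zagier–Kolyvagin), by `Rank1Residual.pPartRankZero_twist_of_mazurMC_typeA`.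
[cite: CastellaEtAl2021, Thm. 5.1.4] [cite: GreenbergVatsal2000, Thm. (1.3)] -/
theorem partnerPPartRankZeroOnX1_of_mazurMainConjectureOnX1TypeA (hA : MazurMainConjectureOnX1TypeA)
    (hGV : GreenbergVatsal2000.thm13_charIdeal_eq_of_gvPar) (hGr : greenberg_charValue_rankZero)
    (hmod : nonempty_modularParametrizationData) (hGZK : rank_eq_analyticRank_of_analyticRank_le_one) :
    PartnerPPartRankZeroOnX1 := by
  intro W _ _ p _ hX1 _ K _ _ hK hodd _ _ hsplit hLK Wd _ _ hWd _
  exact pPartRankZero_twist_of_mazurMC_typeA hGV hGr hmod hGZK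
    (fun W' _ _ p' _ hX1' hA' ↦ hA W' p' hX1' hA') W p hX1 K hK hodd hsplit hLK Wd hWd

/-! ### APPEND (x1a gen 2): the typed residue is needed in RANK ZERO only -/

/-- **The class statement X1 from Keller–Yin's display and Mazur's (MC) at the RANK-ZERO class-X1
pairs only.** `BSDpOnClassX1` follows from (OPEN, announced) `KellerYin2024.thm421_rankOne_display_OPEN`
(Keller–Yin Thms. 3.0.11 + 7.0.6), (OPEN, unstated in print) Mazur's (MC) `MazurMainConjecture W p` for
every class-X1 pair `(W,p)` with `ord_{s=1} L(E,s) = 0` (these are of parity type A by the class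
predicate) — a WEAKER input than `MazurMainConjectureOnX1TypeA`, which also covers the rank-`1` type-A
pairs — and the PUBLISHED named facts (Greenberg–Vatsal 2000, Greenberg 1999 Thm. 4.1, modularity,
Hoffstein–Luo 1997, Gross–Zagier 1986 I.7.3, Gross–Zagier–Kolyvagin). Rank `0`:
`bsdp_of_classX1_of_analyticRank_eq_zero`; rank `1`: the partner `E^K` is a rank-`0` curve, of type B
(Greenberg–Vatsal) or a rank-`0` class-X1 pair at the same prime
(`Rank1Residual.bsdp_of_classX1_of_analyticRank_eq_one_of_KY_OPEN_of_bsdp_rankZero`,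
`ClassX1KellerYinRankOneReduction.lean`). [cite: KellerYin2024, Thm. 4.2.1 (p. 22) and §0.5]
[cite: CastellaEtAl2021, Thms. 5.1.4, 5.3.1] -/
theorem bsdpOnClassX1_of_KY_of_mazurMC_rankZero
    (hA0 : ∀ (W : WeierstrassCurve ℚ) [W.IsElliptic] [W.IsGloballyMinimal] (p : ℕ) [Fact p.Prime],
      ClassX1 W p → W.analyticRank = 0 → MazurMainConjecture W p)
    (hKY : KellerYin2024.thm421_rankOne_display_OPEN)
    (hGV : GreenbergVatsal2000.thm13_charIdeal_eq_of_gvPar) (hGr : greenberg_charValue_rankZero)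
    (hmod : nonempty_modularParametrizationData) (hmod' : exists_isNewformOf)
    (hHL : HoffsteinLuo1997_exists_twist_L_one_ne_zero) (hGZ : GrossZagier1986_thm_I_7_3)
    (hGZK : rank_eq_analyticRank_of_analyticRank_le_one) : BSDpOnClassX1 := by
  intro W _ _ p _ hX1 hr
  have h0 : ∀ (W' : WeierstrassCurve ℚ) [W'.IsElliptic] [W'.IsGloballyMinimal],
      ClassX1 W' p → W'.analyticRank = 0 → BSDp W' p :=
    fun W' _ _ hX1' hr0 ↦
      bsdp_of_classX1_of_analyticRank_eq_zero hGr hmod hGZK W' p hX1' hr0 (hA0 W' p hX1' hr0)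
  rcases Nat.le_one_iff_eq_zero_or_eq_one.mp hr with h0r | h1
  · exact h0 W hX1 h0r
  · exact Rank1Residual.bsdp_of_classX1_of_analyticRank_eq_one_of_KY_OPEN_of_bsdp_rankZero hGV hGr
      hmod hmod' hHL hGZ hGZK hKY W p hX1 h1 h0

/-- **X1 is its rank-zero half plus Keller–Yin.** Granted Keller–Yin's rank-one display (`hKY`,
PREPRINT) and the published named facts: the class statement `BSDpOnClassX1` holds iff `BSD(E,p)`
holds at every class-X1 pair of analytic rank `0` — and there it is EQUIVALENT to Mazur's (MC)
(`Rank1ResidualX1Converse.mazurMainConjecture_iff_bsdp`, x1b). So the cell's residual for X1 is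
exactly: Keller–Yin Thms. 3.0.11 + 7.0.6 (announced) and Mazur's (MC) at the rank-`0` anomalous
Eisenstein pairs of type A (unstated in print); X1b ∩ {r = 1} is not an independent item.
[cite: KellerYin2024, Thm. 4.2.1 (p. 22)] -/
theorem bsdpOnClassX1_iff_rankZero_of_KY (hKY : KellerYin2024.thm421_rankOne_display_OPEN)
    (hGV : GreenbergVatsal2000.thm13_charIdeal_eq_of_gvPar) (hGr : greenberg_charValue_rankZero)
    (hmod : nonempty_modularParametrizationData) (hmod' : exists_isNewformOf)
    (hHL : HoffsteinLuo1997_exists_twist_L_one_ne_zero) (hGZ : GrossZagier1986_thm_I_7_3)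
    (hGZK : rank_eq_analyticRank_of_analyticRank_le_one) :
    BSDpOnClassX1 ↔
      ∀ (W : WeierstrassCurve ℚ) [W.IsElliptic] [W.IsGloballyMinimal] (p : ℕ) [Fact p.Prime],
        ClassX1 W p → W.analyticRank = 0 → BSDp W p := by
  constructor
  · intro h W _ _ p _ hX1 hr0
    exact h W p hX1 (by omega)
  · intro h0 W _ _ p _ hX1 hr
    exact (Rank1Residual.forall_bsdp_classX1_iff_forall_rankZero_of_KY_OPEN hGV hGr hmod hmod' hHL hGZ
      hGZK hKY p).mpr (fun W' _ _ hX1' hr0 ↦ h0 W' p hX1' hr0) W hX1 hr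

/-! ### (gen 3) The parity type on X1 is a function of the isogeny class; X1a by a torsion point

Prover x1a gen 3 (`Rank1Residual/GVParityOrdinaryLineProofs.lean`, `GVParityLineTypeProofs.lean`,
`GVParityIsogenyClassProofs.lean`): Serre's ordinary line (hL) and the signs of complex conjugation
(hc) are theorems at every good ordinary odd `p`, so the Greenberg–Vatsal type of a rational
`p`-isogeny kernel depends neither on the kernel nor on the curve within its `ℚ`-isogeny class, and a
rational point of order `p` anywhere in the class forces type A (`¬ GVPar`) — with NO residual
hypothesis. -/

/-- **The sub-classes X1a / X1b are unions of `ℚ`-isogeny classes.** For globally minimal elliptic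
`W, W'` over `ℚ`, an odd prime `p` which is an anomalous Eisenstein prime of good reduction of both
(`Anom`), and `IsIsogenous W W'`: `GVPar W p ↔ GVPar W' p` (Serre 1972 §1.11 Prop. 11 + Cor.,
Weil pairing, Silverman *AEC* Cor. III.4.11; tree theorem `gvPar_iff_of_isIsogenous_of_anom`).
The census types of `b2b-bsdres-x1a/X1-CENSUS-g2.md` are per Cremona class by this theorem (and
were checked curve by curve). [folklore] -/
theorem gvPar_iff_of_isIsogenous (W W' : WeierstrassCurve ℚ) [W.IsElliptic] [W.IsGloballyMinimal]
    [W'.IsElliptic] [W'.IsGloballyMinimal] (p : ℕ) [Fact p.Prime] (hp2 : p ≠ 2) (hW : Anom W p)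
    (hW' : Anom W' p) (h : IsIsogenous W W') : GVPar W p ↔ GVPar W' p :=
  Rank1Residual.gvPar_iff_of_isIsogenous_of_anom hp2 hW hW' h

/-- **A rational point of order `p` in the isogeny class puts an X1 pair in type A**: for a class-X1
pair `(W, p)`, a globally minimal `W'` anomalous at `p` with `IsIsogenous W W'` (e.g. `W' = W`) and
`P ∈ E'(ℚ)` of order `p`: `¬ GVPar W p`. (Census: 1438 of the 1487 type-A classes `N < 2·10⁴`
contain such a curve; no type-B class does.) [folklore] -/
theorem not_gvPar_of_isIsogenous_of_torsion (W W' : WeierstrassCurve ℚ) [W.IsElliptic]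
    [W.IsGloballyMinimal] [W'.IsElliptic] [W'.IsGloballyMinimal] (p : ℕ) [Fact p.Prime]
    (hX1 : ClassX1 W p) (hW' : Anom W' p) (h : IsIsogenous W W')
    (P : W'.toAffine.Point) (hP0 : P ≠ 0) (hpP : p • P = 0) : ¬ GVPar W p :=
  Rank1Residual.not_gvPar_of_isIsogenous_of_nsmul_eq_zero hX1.1.ne' hX1.2.2.2.1 hW' h P hP0 hpP

/-- **X1 ∩ {r = 1} with a rational point of order `p` in the isogeny class ⇒ `BSD(E,p)` modulo ONLY
Keller–Yin's rank-one display** (named-input form; `bsdp_of_classX1_typeA_of_analyticRank_eq_one`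
with type A supplied by `not_gvPar_of_isIsogenous_of_torsion`). Inputs:
`KellerYin2024.thm421_rankOne_display_OPEN` (OPEN, announced: KY Thms. 3.0.11 + 7.0.6,
arXiv:2402.12781v2) and the PUBLISHED `GreenbergVatsal2000.thm13_charIdeal_eq_of_gvPar`,
`greenberg_charValue_rankZero`, `nonempty_modularParametrizationData`, `exists_isNewformOf`,
`HoffsteinLuo1997_exists_twist_L_one_ne_zero`, `GrossZagier1986_thm_I_7_3`,
`rank_eq_analyticRank_of_analyticRank_le_one`. A criterion read off the torsion structure of the
Cremona class (e.g. `11a1@5` has `E(ℚ)_tors = ℤ/5`). [cite: KellerYin2024, Thm. 4.2.1 and its proof (p. 22)] -/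
theorem bsdp_of_classX1_of_analyticRank_eq_one_of_torsion
    (hKY : KellerYin2024.thm421_rankOne_display_OPEN)
    (hGV : GreenbergVatsal2000.thm13_charIdeal_eq_of_gvPar) (hGr : greenberg_charValue_rankZero)
    (hmod : nonempty_modularParametrizationData) (hmod' : exists_isNewformOf)
    (hHL : HoffsteinLuo1997_exists_twist_L_one_ne_zero) (hGZ : GrossZagier1986_thm_I_7_3)
    (hGZK : rank_eq_analyticRank_of_analyticRank_le_one)
    (W W' : WeierstrassCurve ℚ) [W.IsElliptic] [W.IsGloballyMinimal] [W'.IsElliptic]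
    [W'.IsGloballyMinimal] (p : ℕ) [Fact p.Prime] (hX1 : ClassX1 W p) (hr : W.analyticRank = 1)
    (hW' : Anom W' p) (h : IsIsogenous W W') (P : W'.toAffine.Point) (hP0 : P ≠ 0)
    (hpP : p • P = 0) : BSDp W p :=
  bsdp_of_classX1_typeA_of_analyticRank_eq_one hKY hGV hGr hmod hmod' hHL hGZ hGZK W p hX1
    (not_gvPar_of_isIsogenous_of_torsion W W' p hX1 hW' h P hP0 hpP) hr

end Summit.BirchSwinnertonDyer.BirchSwinnertonDyer.Theorems.Rank1ResidualX1Defs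

end
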